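import Summits.ResolutionOfSingularities.ResolutionOfSingularities.Theorems.HironakaBridge
import Summits.ResolutionOfSingularities.ResolutionOfSingularities.Theorems.DescentDescentPerfectToAllRungBZero
import Summits.ResolutionOfSingularities.ResolutionOfSingularities.Theorems.DescentDescentPerfectToAllLevelResolution

/-!
# RUNG B links discharged: `B0 p` and `B1 p` hold, and rung B is EXACTLY the `p`-slice of the crux
# `DescentPerfectToAll` (stmt-ResolutionOfSingularities-0549)

Cell `res-hironaka`, LADDER-RESOLUTION rung B (OURS; nothing here is a statement of any manuscript and
no candidate statement is asserted — candidates enter only as hypotheses). The definitions are those of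
`Theorems/HironakaBridge.lean` (`PerfectRes`, `PrimeFieldRes`, `FgLevelRes`, `EmbeddedSmoothResPerfect`,
`HironakaERSPerfect`, `ERSToEmbeddedSmoothRes`, `B0`, `B1`, `B2`, `DescentAt`, `RungB`), stated there
without proofs. This file PROVES:

* `b0_holds : ∀ p, B0 p` — embedded resolution in smooth irreducible ambients over perfect fields ⇒
  `PerfectRes p` (Chow; `Theorems.rungB0`, `DescentDescentPerfectToAllRungBZero.lean`). GAP row G8-b.
* `fgLevelRes_of_primeFieldRes` / `b1_holds : ∀ p [Fact p.Prime], B1 p` — resolution over the PRIME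
  field `ZMod p` alone ⇒ resolution over every finitely generated field of characteristic `p`
  (spreading out over a finitely generated `𝔽_p`-algebra `R` with `Frac R = L`, resolving the model
  over `𝔽_p`, generic fibre). The proof is that of `Theorems.stub_levelResolution`
  (`DescentDescentPerfectToAllLevelResolution.lean`, line `arc-special-fibre-transversality` of the
  08-17 crux campaign) run VERBATIM with its perfect-field hypothesis weakened to the prime field — that
  proof instantiated the hypothesis only at `ZMod p`. GAP row G8-c (the kernel form of a
  transcendence-degree remark; OURS).
* `embeddedSmoothResPerfect_of_perfectRes` — conversely to `B0`, `PerfectRes p` trivially contains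
  `EmbeddedSmoothResPerfect p` (an integral closed subscheme of a separated quasi-compact smooth
  `K`-scheme is a reduced separated `K`-scheme of finite type); hence
  `embeddedSmoothResPerfect_iff_perfectRes : EmbeddedSmoothResPerfect p ↔ PerfectRes p`.
* `rungB_iff_descentAt : RungB p ↔ DescentAt p` and
  `forall_rungB_iff_descentPerfectToAll : (∀ p prime, RungB p) ↔ DescentPerfectToAll` —
  **rung B is literally the crux stmt-0549**: whatever is adjudicated about embedded resolution over
  perfect fields, the passage to the summit conjunct over ALL fields of characteristic `p` is exactly
  `DescentPerfectToAll`, no more and no less.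
* `resolutionInChar_of_hironakaERSPerfect'`, `resolutionOfSingularities_of_mainClaimPerfect` — the
  chain from the TYPED §1 candidate (perfect-`K` reading, `S01Introduction.MainClaimPerfect`, consumed as
  a hypothesis) to the summit, with the only remaining hypotheses the G8-a glue
  `ERSToEmbeddedSmoothRes p` (typed ERS ⇒ its non-embedded consequence-shape; expected provable from
  the tree, not proved here) and the crux `DescentPerfectToAll` itself.

## References
* plan/RUNG-B.md v0.1 (res-plan-1), lit/RUNG-B-LIT.md §3–§4 (res-lit-3) — cell files, OURS.
* M. Temkin, Adv. Math. 219 (2008), Question 3.3.3 (perfect ⇒ all fields is open). [Temkin2008]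
-/

noncomputable section

set_option linter.dupNamespace false -- mandated namespace of this single-conjunct summit

namespace Summit.ResolutionOfSingularities.ResolutionOfSingularities.Theorems

open CategoryTheory CategoryTheory.Limits AlgebraicGeometry MonoidalCategory Opposite TopologicalSpace
open Literature.AlgebraicGeometry.Limits Literature.AlgebraicGeometry.Morphisms
open Literature.AlgebraicGeometry.Resolution
open Literature.AlgebraicGeometry.Motives (SchemeOver specOver)

-- As in `DescentDescentPerfectToAllLevelResolution.lean`: the cone legs `c.π.app i` have source
-- `((Functor.const _).obj c.pt).obj i`, definitionally `c.pt`.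
set_option backward.isDefEq.respectTransparency false

/-! ## B0 -/

/-- **`B0 p` holds**: embedded resolution of integral closed subschemes of smooth irreducible separated
quasi-compact schemes over perfect fields of characteristic `p` implies `PerfectRes p` (Chow's lemma;
`Theorems.rungB0`). GAP row G8-b of plan/RUNG-B.md. [folklore] -/
theorem b0_holds (p : ℕ) : B0 p := rungB0 p

/-- Conversely, `PerfectRes p` contains `EmbeddedSmoothResPerfect p`: an integral closed subscheme
`i : X ↪ Z` of a separated quasi-compact smooth `K`-scheme is a reduced separated `K`-scheme of finite
type via `i ≫ g`. [folklore] -/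
theorem embeddedSmoothResPerfect_of_perfectRes {p : ℕ} (h : PerfectRes p) :
    EmbeddedSmoothResPerfect p := by
  intro K _ _ _ Z X g i hsep hlft hqc _ _ hi hint
  haveI := hsep; haveI := hlft; haveI := hqc; haveI := hi; haveI := hint
  exact h K X (i ≫ g) inferInstance inferInstance inferInstance inferInstance

/-- `EmbeddedSmoothResPerfect p ↔ PerfectRes p` (`b0_holds` and the trivial converse). [folklore] -/
theorem embeddedSmoothResPerfect_iff_perfectRes (p : ℕ) : EmbeddedSmoothResPerfect p ↔ PerfectRes p :=
  ⟨b0_holds p, embeddedSmoothResPerfect_of_perfectRes⟩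

/-! ## B1: the prime field suffices for all finitely generated fields -/

/-- **Resolution over `𝔽_p` ⇒ resolution over every finitely generated field of characteristic `p`.**
If every reduced separated scheme of finite type over the prime field `ZMod p` admits a resolution,
then so does every reduced separated scheme of finite type over a finitely generated subfield
`L = closure t` of any field `k` of characteristic `p`: spread `Z` out to a model over a finitely
generated `𝔽_p`-algebra `R ⊆ L` with `Frac R = L`, resolve the model over `𝔽_p`, and pass to the
generic fibre (flat, surjective on stalks: `hasResolution_pullback_of_flat_of_surjectiveOnStalks`). The
proof is verbatim that of `Theorems.stub_levelResolution`, whose perfect-field hypothesis was used only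
at `ZMod p`. [folklore] -/
theorem fgLevelRes_of_primeFieldRes (p : ℕ) [Fact p.Prime] : PrimeFieldRes p → FgLevelRes p := by
  intro H k _ _ L t hL Z g hsep hlft hqc hred
  classical
  -- ### Step 1: a closed `L`-immersion into a finite type model over a finitely generated subring
  obtain ⟨A₀, _, φ, Y₀, p₀, j, hNoeth, hfgA, -, hpsep, hplft, hpqc, hj, hjg⟩ :=
    exists_finiteTypeModel g
  letI : Algebra A₀ L := φ.toAlgebra
  haveI := hNoeth
  let P : SchemeOver A₀ := Over.mk p₀
  haveI : IsSeparated P.hom := hpsep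
  haveI : QuasiCompact P.hom := hpqc
  haveI : LocallyOfFiniteType P.hom := hplft
  let jY : Z ⟶ (P ⊗ specOver A₀ L).left := j
  haveI : IsClosedImmersion jY := hj
  have hg : jY ≫ pullback.snd P.hom (specOver A₀ L).hom = g := hjg
  -- the finite generating set `t`, seen inside `L`
  let tL : Finset L := t.subtype (· ∈ L)
  -- ### Step 2: the closed subscheme `Z` descends to a stage `R = A₀[t'] ⊆ L`, `t ⊆ t'`
  haveI : IsLocallyNoetherian (SubalgApprox.prodCone A₀ L tL P).pt := by
    haveI : IsLocallyNoetherian (specOver A₀ L).left :=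
      inferInstanceAs (IsLocallyNoetherian (Spec (.of L)))
    change IsLocallyNoetherian (pullback P.hom (specOver A₀ L).hom)
    exact LocallyOfFiniteType.isLocallyNoetherian (pullback.snd P.hom (specOver A₀ L).hom)
  obtain ⟨i, hi⟩ := exists_isPullback_toImage_of_isLocallyNoetherian
    (SubalgApprox.prodDiagram A₀ L tL P) (SubalgApprox.prodCone A₀ L tL P)
    (SubalgApprox.isLimitProdCone A₀ L tL P) jY
  have HX := hi i (𝟙 i)
  let R : Subalgebra A₀ L := SubalgApprox.sub A₀ L i.unop.1
  let π : (P ⊗ specOver A₀ L).left ⟶ (SubalgApprox.prodDiagram A₀ L tL P).obj i :=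
    (SubalgApprox.prodCone A₀ L tL P).π.app i
  have Hleg : IsPullback π (pullback.snd P.hom (specOver A₀ L).hom)
      (pullback.snd P.hom (specOver A₀ R).hom)
      (Spec.map (CommRingCat.ofHom (algebraMap R L))) :=
    SubalgApprox.isPullback_whiskerLeft_left P ((SubalgApprox.baseCone A₀ L tL).π.app i)
  let Xt : Scheme.{0} := (jY ≫ π).image
  let πt : Z ⟶ Xt := (jY ≫ π).toImage
  let ft : Xt ⟶ Spec (.of R) := (jY ≫ π).imageι ≫ pullback.snd P.hom (specOver A₀ R).hom
  let s : Spec (.of L) ⟶ Spec (.of R) := Spec.map (CommRingCat.ofHom (algebraMap R L))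
  have Hmain : IsPullback πt g ft s := by
    have h := HX.flip.paste_vert Hleg
    rwa [hg] at h
  -- `Z_R = Xt` is reduced, and separated of finite type over `R`
  haveI : IsReduced Xt := ChowLemmaProof.isReduced_image (jY ≫ π)
  haveI : IsSeparated ft := inferInstance
  haveI : LocallyOfFiniteType ft := inferInstance
  haveI : QuasiCompact ft := inferInstance
  -- ### Step 3: `R` is of finite type over the perfect field `𝔽_p`; resolve `Z_R`
  have hinj : Function.Injective (algebraMap R L) := fun x y hxy => Subtype.ext hxy
  haveI : CharP R p := (algebraMap R L).charP hinj p
  let ψ : ZMod p →+* R := ZMod.castHom (dvd_refl p) R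
  have hψ : ψ.FiniteType := by
    have h1 : Algebra.FiniteType ℤ R := hfgA.trans inferInstance
    have h2 : (algebraMap ℤ R).FiniteType := RingHom.finiteType_algebraMap.mpr h1
    have h3 : algebraMap ℤ R = ψ.comp (Int.castRingHom (ZMod p)) := RingHom.ext_int _ _
    rw [h3] at h2
    exact RingHom.FiniteType.of_comp_finiteType h2
  let b : Spec (.of R) ⟶ Spec (.of (ZMod p)) := Spec.map (CommRingCat.ofHom ψ)
  haveI : LocallyOfFiniteType b := by
    rw [HasRingHomProperty.Spec_iff (P := @LocallyOfFiniteType)]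
    exact hψ
  haveI : IsSeparated (ft ≫ b) := inferInstance
  haveI : LocallyOfFiniteType (ft ≫ b) := inferInstance
  haveI : QuasiCompact (ft ≫ b) := inferInstance
  obtain ⟨Y, πr, hres⟩ := H Xt (ft ≫ b) inferInstance inferInstance inferInstance inferInstance
  -- ### Step 4: `L = Frac R`, so `Spec L → Spec R` is a flat preimmersion
  have htR : ∀ x ∈ t, ∃ hx : x ∈ L, (⟨x, hx⟩ : L) ∈ R := fun x hx => by
    have hxL : x ∈ L := by
      rw [hL]
      exact Subfield.subset_closure (Finset.mem_coe.2 hx)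
    exact ⟨hxL, Algebra.subset_adjoin (Finset.mem_coe.2 (i.unop.2 (Finset.mem_subtype.2 hx)))⟩
  have hsurj : ∀ z : L, ∃ x y : R, z = algebraMap R L x / algebraMap R L y := by
    intro z
    have hz : (z : k) ∈ Subfield.closure (↑t : Set k) := by
      rw [← hL]
      exact z.2
    obtain ⟨y, hy, w, hw, hyw⟩ := Subfield.mem_closure_iff.mp hz
    have hle : Subring.closure (↑t : Set k) ≤ R.toSubring.map L.subtype :=
      Subring.closure_le.mpr fun x hx => by
        obtain ⟨hxL, hxR⟩ := htR x (Finset.mem_coe.1 hx)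
        exact ⟨⟨x, hxL⟩, hxR, rfl⟩
    obtain ⟨r, hr, rfl⟩ := hle hy
    obtain ⟨r', hr', rfl⟩ := hle hw
    refine ⟨⟨r, hr⟩, ⟨r', hr'⟩, Subtype.ext ?_⟩
    change (z : k) = (((r / r' : L)) : k)
    rw [Subfield.coe_div]
    exact hyw.symm
  haveI : FaithfulSMul R L := (faithfulSMul_iff_algebraMap_injective R L).mpr hinj
  haveI : IsFractionRing R L := IsFractionRing.of_field R L hsurj
  haveI : IsPreimmersion s := IsPreimmersion.of_isLocalization (nonZeroDivisors R)
  haveI : Flat s := by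
    rw [Flat.SpecMap_iff, CommRingCat.hom_ofHom]
    exact RingHom.flat_algebraMap_iff.mpr (IsLocalization.flat L (nonZeroDivisors R))
  -- ### Step 5: the generic fibre of the resolution of `Z_R` resolves `Z ≅ Z_R ×_R Spec L`
  haveI := hres.isProper
  haveI : IsNoetherian Xt := Scheme.isNoetherian_of_finiteType_over_field (ft ≫ b)
  haveI : IsNoetherian Y := Scheme.isNoetherian_of_finiteType_over_field (πr ≫ ft ≫ b)
  exact (hasResolution_pullback_of_flat_of_surjectiveOnStalks ft s πr hres).of_iso
    Hmain.isoPullback.inv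

/-- **`B1 p` holds** (`PrimeFieldRes p → FgLevelRes p`). GAP row G8-c of plan/RUNG-B.md. [folklore] -/
theorem b1_holds (p : ℕ) [Fact p.Prime] : B1 p := fgLevelRes_of_primeFieldRes p

/-- `PerfectRes p → FgLevelRes p` (through the prime field; equivalently `Theorems.stub_levelResolution`).
[folklore] -/
theorem fgLevelRes_of_perfectRes {p : ℕ} [Fact p.Prime] (h : PerfectRes p) : FgLevelRes p :=
  b1_holds p (primeFieldRes_of_perfectRes h)

/-! ## Rung B is exactly the `p`-slice of stmt-0549 -/

/-- `DescentAt p → RungB p` (with `B0` discharged). [folklore] -/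
theorem rungB_of_descentAt {p : ℕ} (hd : DescentAt p) : RungB p :=
  rungB_of_b0_of_descentAt p (b0_holds p) hd

/-- `RungB p → DescentAt p` (the antecedent `PerfectRes p` of the slice yields the antecedent
`EmbeddedSmoothResPerfect p` of rung B). [folklore] -/
theorem descentAt_of_rungB {p : ℕ} (hB : RungB p) : DescentAt p :=
  fun hP => hB (embeddedSmoothResPerfect_of_perfectRes hP)

/-- **Rung B is literally the `p`-slice of the crux stmt-0549**: `RungB p ↔ DescentAt p`. [folklore] -/
theorem rungB_iff_descentAt (p : ℕ) : RungB p ↔ DescentAt p :=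
  ⟨descentAt_of_rungB, rungB_of_descentAt⟩

/-- **Rung B over all primes is literally `DescentPerfectToAll`** (stmt-ResolutionOfSingularities-0549).
[folklore] -/
theorem forall_rungB_iff_descentPerfectToAll :
    (∀ p : ℕ, p.Prime → RungB p) ↔
      Summit.ResolutionOfSingularities.ResolutionOfSingularities.Theses.Descent.DescentPerfectToAll := by
  rw [descentPerfectToAll_iff]
  exact forall₂_congr fun p _ => rungB_iff_descentAt p

/-- With `B1` discharged, the residual `B2 p` alone implies the `p`-slice of stmt-0549. [folklore] -/
theorem descentAt_of_b2 {p : ℕ} [Fact p.Prime] (h2 : B2 p) : DescentAt p :=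
  b2_imp_descentAt p (b1_holds p) h2

/-! ## The chain from the typed candidate, with `B0` and `B1` discharged -/

/-- From the typed §1 candidate at `p` (hypothesis `hH`), the G8-a glue (hypothesis `hA`) and the
residual `B2 p` (hypothesis): `ResolutionInChar p`. No candidate is asserted. [folklore] -/
theorem resolutionInChar_of_hironakaERSPerfect' (p : ℕ) [Fact p.Prime]
    (hA : ERSToEmbeddedSmoothRes p) (h2 : B2 p) (hH : HironakaERSPerfect p) :
    ResolutionInChar.{0} p :=
  resolutionInChar_of_hironakaERSPerfect p hA (b0_holds p) (b1_holds p) h2 hH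

/-- From the typed §1 candidate at `p`, the G8-a glue and the `p`-slice of stmt-0549: `ResolutionInChar p`.
[folklore] -/
theorem resolutionInChar_of_hironakaERSPerfect_of_descentAt (p : ℕ)
    (hA : ERSToEmbeddedSmoothRes p) (hd : DescentAt p) (hH : HironakaERSPerfect p) :
    ResolutionInChar.{0} p :=
  rungB_of_descentAt hd (hA hH)

/-- **The whole ladder, kernel form**: the TYPED §1 candidate read with perfect `K`
(`S01Introduction.MainClaimPerfect`, a hypothesis), the G8-a glue for every prime (a hypothesis,
expected provable) and the crux `DescentPerfectToAll` (stmt-0549, open) give the summit statement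
`ResolutionOfSingularities`. `B0`/`B1` no longer appear. [folklore] -/
theorem resolutionOfSingularities_of_mainClaimPerfect
    (hH : Literature.AlgebraicGeometry.Hironaka2017.S01Introduction.MainClaimPerfect.{0})
    (hA : ∀ p : ℕ, p.Prime → ERSToEmbeddedSmoothRes p)
    (hd : Summit.ResolutionOfSingularities.ResolutionOfSingularities.Theses.Descent.DescentPerfectToAll) :
    _root_.ResolutionOfSingularities :=
  _root_.ResolutionOfSingularities_iff.mpr
    (resolutionInChar_of_mainClaimPerfect hH hA (fun p _ => b0_holds p) hd)

end Summit.ResolutionOfSingularities.ResolutionOfSingularities.Theorems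

end
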